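import Summits.CriticalPhenomena.PercolationContinuityZ3.Theorems.PercNearOneGluingNoHeavyLowerTailSahiOneStepFuzzyCompressionPrelim
import Mathlib.Topology.MetricSpace.ProperSpace
import Mathlib.Topology.Order.Basic
import HarnessLib

/-!
# One-step scheme: THE FUZZY COMPRESSION LEMMA — a left-shifted surrogate with prescribed masses exists at every interior density

Support file (prover prim-ineq-prove-3 gen 30; `--supports stmt-CriticalPhenomena-4575`; memo `…/prim-ineq-prove-3/PROOF-G30-SHIFTED-PARTNER.md`
§2).  No definitions, no named facts, no sorries, no `native_decide`.  Part 1 (`…FuzzyCompressionPrelim`): the averaging compression.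
§3: pair sums (`sum_eq_sum_pairs`) and, for any `g` with the shape of the averaging compression of `f` (hypotheses `hm`, `hg`, `hg0`):
`pair_balance`, `ex_pairConst_avgCompress` (pair-symmetric masses preserved), `ex_rightClosed_avgCompress_le` (overlaps with trade-closed
events do not increase), `energy_avgCompress_lt` (`E[g²] < E[f²]` if a pair is unsorted); packaged definition-free: `exists_avgCompression`.
§4 `exists_leftShifted_surrogate`: for `p ∈ (0,1)^ι`, `F` ranked by `σ`, `H` invariant under trades inside `F` (e.g. `Th_t(F)`), `B` closed
under upward trades (e.g. right-shifted) and `f₀` increasing `F`-determined `[0,1]`-valued (e.g. `1_A`), there is such a `φ`, LEFT-SHIFTED, with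
`E[1_H φ] = E[1_H f₀]`, `E φ = E f₀`, `E[1_H φ 1_B] ≤ E[1_H f₀ 1_B]`: the minimiser of `E[φ²]` over the compact admissible set, which no averaging
compression can improve.  With `…FuzzyReduce` + `…OppositeShifted`: THEOREM SP (`…ShiftedPartner`).
-/

noncomputable section

namespace Summit.CriticalPhenomena.PercolationContinuityZ3.Theorems

namespace SahiOneStep

open Literature.Combinatorics.Sahi2008
open Literature.Probability.Percolation (DeterminedBy determinedBy_iff)
open Literature.Probability.Percolation.DecisionTree (ind ind_of_mem ind_of_not_mem ind_nonneg)
open Literature.Probability.Percolation.BHK2006 (weight weight_nonneg)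
open Literature.Probability.LatticeModels (prodBernoulli)
open SahiCdd (ex_congr' ex_lin2)
open scoped Classical

variable {ι : Type*} [Fintype ι]

section avg
variable (p : ι → unitInterval) (hp : ∀ e, 0 < (p e : ℝ) ∧ (p e : ℝ) < 1) (i j : ι)
/- the weighted mean `m u v = (pᵢqⱼu + qᵢpⱼv)/(pᵢqⱼ + qᵢpⱼ)` as a hypothesis fixing its formula (no definition) -/
variable (m : ℝ → ℝ → ℝ) (hm : ∀ u v, m u v = ((p i : ℝ) * (1 - (p j : ℝ)) * u + (1 - (p i : ℝ)) * (p j : ℝ) * v) / ((p i : ℝ) * (1 - (p j : ℝ)) + (1 - (p i : ℝ)) * (p j : ℝ)))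
include hp hm

omit [Fintype ι] in
/-- The weighted mean lies between its arguments. [folklore] -/
private theorem wavg_mem' (u v : ℝ) : min u v ≤ m u v ∧ m u v ≤ max u v := by
  obtain ⟨ha, hb⟩ := coef_pos p hp i j
  rw [hm]
  set a := (p i : ℝ) * (1 - (p j : ℝ)); set b := (1 - (p i : ℝ)) * (p j : ℝ)
  have hab : 0 < a + b := add_pos ha hb
  constructor
  · rw [le_div_iff₀ hab]
    nlinarith [min_le_left u v, min_le_right u v]
  · rw [div_le_iff₀ hab]
    nlinarith [le_max_left u v, le_max_right u v]

/-! ## §3 Sums over pairs -/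

omit hp hm in
/-- **Pair decomposition of a sum.**  If `G` vanishes off the pairs `(S+i, S+j)`, then `Σ_ω G(ω) = Σ_{S} (G(S+i) + G(S+j))`. [folklore] -/
theorem sum_eq_sum_pairs (hij : i ≠ j) (G : Set ι → ℝ) (h0 : ∀ ω : Set ι, ¬ (i ∈ ω ∧ j ∉ ω) → ¬ (j ∈ ω ∧ i ∉ ω) → G ω = 0) :
    ∑ ω, G ω = ∑ ω ∈ Finset.univ.filter (fun ω : Set ι => i ∈ ω ∧ j ∉ ω), (G ω + G ((ω \ {i}) ∪ {j})) := by
  rw [Finset.sum_add_distrib, ← Finset.sum_filter_add_sum_filter_not Finset.univ (fun ω : Set ι => i ∈ ω ∧ j ∉ ω) G]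
  congr 1
  rw [← Finset.sum_filter_add_sum_filter_not _ (fun ω : Set ι => j ∈ ω ∧ i ∉ ω) G]
  have hrest : ∑ ω ∈ (Finset.univ.filter (fun ω : Set ι => ¬ (i ∈ ω ∧ j ∉ ω))).filter (fun ω : Set ι => ¬ (j ∈ ω ∧ i ∉ ω)), G ω = 0 :=
    Finset.sum_eq_zero fun ω hω => by
      rw [Finset.mem_filter, Finset.mem_filter] at hω
      exact h0 ω hω.1.2 hω.2
  rw [hrest, add_zero]
  -- reindex the `Q`-part by the trade
  refine Finset.sum_nbij' (fun ω => (ω \ {j}) ∪ {i}) (fun ω => (ω \ {i}) ∪ {j}) ?_ ?_ ?_ ?_ ?_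
  · intro ω _
    exact Finset.mem_filter.2 ⟨Finset.mem_univ _, Or.inr rfl, fun h => h.elim (fun h' => h'.2 rfl) fun h' => hij.symm h'⟩
  · intro ω _
    have hni : i ∉ (ω \ {i}) ∪ {j} := fun h => h.elim (fun h' => h'.2 rfl) fun h' => hij h'
    rw [Finset.mem_filter, Finset.mem_filter]
    exact ⟨⟨Finset.mem_univ _, fun h => hni h.1⟩, Or.inr rfl, hni⟩
  · intro ω hω
    rw [Finset.mem_filter, Finset.mem_filter] at hω
    exact trade_trade hij.symm hω.2.1 hω.2.2
  · intro ω hω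
    exact trade_trade hij (Finset.mem_filter.1 hω).2.1 (Finset.mem_filter.1 hω).2.2
  · intro ω hω
    rw [Finset.mem_filter, Finset.mem_filter] at hω
    rw [trade_trade hij.symm hω.2.1 hω.2.2]

variable (f g : Set ι → ℝ)
  (hg : ∀ ω : Set ι, i ∈ ω → j ∉ ω →
    g ω = max (f ω) (m (f ω) (f ((ω \ {i}) ∪ {j}))) ∧
    g ((ω \ {i}) ∪ {j}) = min (f ((ω \ {i}) ∪ {j})) (m (f ω) (f ((ω \ {i}) ∪ {j}))))
  (hg0 : ∀ ω : Set ι, ¬ (i ∈ ω ∧ j ∉ ω) → ¬ (j ∈ ω ∧ i ∉ ω) → g ω = f ω)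
include hg hg0

omit hg0 in
/-- **The pair identity behind the averaging**: `w(S+i)·(g − f)(S+i) + w(S+j)·(g − f)(S+j) = 0`. [this work] -/
theorem pair_balance (hij : i ≠ j) {ω : Set ι} (hi : i ∈ ω) (hj : j ∉ ω) :
    bernoulliWeight p ω * (g ω - f ω) +
      bernoulliWeight p ((ω \ {i}) ∪ {j}) * (g ((ω \ {i}) ∪ {j}) - f ((ω \ {i}) ∪ {j})) = 0 := by
  obtain ⟨h1, h2⟩ := hg ω hi hj
  rw [h1, h2]
  set u := f ω; set v := f ((ω \ {i}) ∪ {j})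
  have hw := bernoulliWeight_trade p hij hi hj
  obtain ⟨ha, hb⟩ := coef_pos p hp i j
  set a := (p i : ℝ) * (1 - (p j : ℝ)) with hadef
  set b := (1 - (p i : ℝ)) * (p j : ℝ) with hbdef
  have hab : 0 < a + b := add_pos ha hb
  by_cases huv : u < v
  · have hmv := wavg_mem' p hp i j m hm u v
    rw [min_eq_left huv.le, max_eq_right huv.le] at hmv
    rw [max_eq_right hmv.1, min_eq_right hmv.2]
    have hmdef : m u v * (a + b) = a * u + b * v := by
      rw [hm]; field_simp
    -- `w(ω) b = w(ω') a`
    have hw' : bernoulliWeight p ω * b = bernoulliWeight p ((ω \ {i}) ∪ {j}) * a := hw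
    have hane : a ≠ 0 := ne_of_gt ha
    -- multiply the claim by `a`
    have key : a * (bernoulliWeight p ω * (m u v - u) +
        bernoulliWeight p ((ω \ {i}) ∪ {j}) * (m u v - v)) = 0 := by
      have e1 : a * (bernoulliWeight p ((ω \ {i}) ∪ {j}) * (m u v - v)) =
          bernoulliWeight p ω * b * (m u v - v) := by rw [hw']; ring
      rw [mul_add, e1]
      have : a * (bernoulliWeight p ω * (m u v - u)) + bernoulliWeight p ω * b * (m u v - v) =
          bernoulliWeight p ω * (m u v * (a + b) - (a * u + b * v)) := by ring
      rw [this, hmdef, sub_self, mul_zero]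
    rcases mul_eq_zero.1 key with h | h
    · exact absurd h hane
    · exact h
  · have hvu : v ≤ u := not_lt.1 huv
    have hmv := wavg_mem' p hp i j m hm u v
    rw [min_eq_right hvu, max_eq_left hvu] at hmv
    rw [max_eq_left hmv.2, min_eq_left hmv.1]
    ring

/-- **Pair-symmetric weighted sums are preserved**: if `c(S+i) = c(S+j)` for all `S`, then `E[c·g] = E[c·f]`. [this work] -/
theorem ex_pairConst_avgCompress (hij : i ≠ j) (c : Set ι → ℝ) (hc : ∀ ω : Set ι, i ∈ ω → j ∉ ω → c ω = c ((ω \ {i}) ∪ {j})) :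
    ex (bernoulliWeight p) (c * g) = ex (bernoulliWeight p) (c * f) := by
  rw [← sub_eq_zero]
  unfold ex
  rw [← Finset.sum_sub_distrib]
  have h := sum_eq_sum_pairs i j hij (fun ω => bernoulliWeight p ω * (c * g) ω - bernoulliWeight p ω * (c * f) ω)
    (fun ω h1 h2 => by simp only [Pi.mul_apply, hg0 ω h1 h2, sub_self])
  rw [h]
  refine Finset.sum_eq_zero fun ω hω => ?_
  rw [Finset.mem_filter] at hω
  have hb := pair_balance p hp i j m hm f g hg hij hω.2.1 hω.2.2
  simp only [Pi.mul_apply]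
  rw [← hc ω hω.2.1 hω.2.2]
  have : bernoulliWeight p ω * (c ω * g ω) - bernoulliWeight p ω * (c ω * f ω) +
      (bernoulliWeight p ((ω \ {i}) ∪ {j}) * (c ω * g ((ω \ {i}) ∪ {j})) -
        bernoulliWeight p ((ω \ {i}) ∪ {j}) * (c ω * f ((ω \ {i}) ∪ {j}))) =
      c ω * (bernoulliWeight p ω * (g ω - f ω) +
        bernoulliWeight p ((ω \ {i}) ∪ {j}) * (g ((ω \ {i}) ∪ {j}) - f ((ω \ {i}) ∪ {j}))) := by ring
  rw [this, hb, mul_zero]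

/-- **Overlaps with a trade-closed event do not increase**: if `S+i ∈ B ⟹ S+j ∈ B` and `c ≥ 0` is pair-symmetric, then
`E[c·1_B·g] ≤ E[c·1_B·f]`. [this work] -/
theorem ex_rightClosed_avgCompress_le (hij : i ≠ j) (c : Set ι → ℝ) (hc : ∀ ω : Set ι, i ∈ ω → j ∉ ω → c ω = c ((ω \ {i}) ∪ {j}))
    (hc0 : ∀ ω, 0 ≤ c ω) {B : Set (Set ι)} (hB : ∀ ω : Set ι, i ∈ ω → j ∉ ω → ω ∈ B → (ω \ {i}) ∪ {j} ∈ B) :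
    ex (bernoulliWeight p) (c * ind B * g) ≤ ex (bernoulliWeight p) (c * ind B * f) := by
  rw [← sub_nonpos]
  unfold ex
  rw [← Finset.sum_sub_distrib]
  have h := sum_eq_sum_pairs i j hij (fun ω => bernoulliWeight p ω * (c * ind B * g) ω - bernoulliWeight p ω * (c * ind B * f) ω)
    (fun ω h1 h2 => by simp only [Pi.mul_apply, hg0 ω h1 h2, sub_self])
  rw [h]
  refine Finset.sum_nonpos fun ω hω => ?_
  rw [Finset.mem_filter] at hω
  obtain ⟨hi, hj⟩ := hω.2
  have hb := pair_balance p hp i j m hm f g hg hij hi hj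
  have hw0 : 0 ≤ bernoulliWeight p ((ω \ {i}) ∪ {j}) := (bernoulliWeight_pos p hp _).le
  -- the value at `S+j` can only decrease
  have hdec : g ((ω \ {i}) ∪ {j}) - f ((ω \ {i}) ∪ {j}) ≤ 0 := by
    rw [(hg ω hi hj).2]; exact sub_nonpos.2 (min_le_left _ _)
  simp only [Pi.mul_apply]
  rw [← hc ω hi hj]
  by_cases hωB : ω ∈ B
  · rw [ind_of_mem hωB, ind_of_mem (hB ω hi hj hωB)]
    have : bernoulliWeight p ω * (c ω * 1 * g ω) - bernoulliWeight p ω * (c ω * 1 * f ω) +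
        (bernoulliWeight p ((ω \ {i}) ∪ {j}) * (c ω * 1 * g ((ω \ {i}) ∪ {j})) -
          bernoulliWeight p ((ω \ {i}) ∪ {j}) * (c ω * 1 * f ((ω \ {i}) ∪ {j}))) =
        c ω * (bernoulliWeight p ω * (g ω - f ω) +
          bernoulliWeight p ((ω \ {i}) ∪ {j}) * (g ((ω \ {i}) ∪ {j}) - f ((ω \ {i}) ∪ {j}))) := by ring
    rw [this, hb, mul_zero]
  · rw [ind_of_not_mem hωB]
    by_cases hω'B : (ω \ {i}) ∪ {j} ∈ B
    · rw [ind_of_mem hω'B]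
      have : bernoulliWeight p ω * (c ω * 0 * g ω) - bernoulliWeight p ω * (c ω * 0 * f ω) +
          (bernoulliWeight p ((ω \ {i}) ∪ {j}) * (c ω * 1 * g ((ω \ {i}) ∪ {j})) -
            bernoulliWeight p ((ω \ {i}) ∪ {j}) * (c ω * 1 * f ((ω \ {i}) ∪ {j}))) =
          c ω * bernoulliWeight p ((ω \ {i}) ∪ {j}) * (g ((ω \ {i}) ∪ {j}) - f ((ω \ {i}) ∪ {j})) := by ring
      rw [this]
      exact mul_nonpos_of_nonneg_of_nonpos (mul_nonneg (hc0 ω) hw0) hdec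
    · rw [ind_of_not_mem hω'B]
      have : bernoulliWeight p ω * (c ω * 0 * g ω) - bernoulliWeight p ω * (c ω * 0 * f ω) +
          (bernoulliWeight p ((ω \ {i}) ∪ {j}) * (c ω * 0 * g ((ω \ {i}) ∪ {j})) -
            bernoulliWeight p ((ω \ {i}) ∪ {j}) * (c ω * 0 * f ((ω \ {i}) ∪ {j}))) = 0 := by ring
      rw [this]

/-- **Energy.**  `E[g²] ≤ E[f²]`, with strict inequality as soon as one pair is unsorted (`f(S+i) < f(S+j)`). [this work] -/
theorem energy_avgCompress_lt (hij : i ≠ j) {ω₀ : Set ι} (hi : i ∈ ω₀) (hj : j ∉ ω₀)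
    (hlt : f ω₀ < f ((ω₀ \ {i}) ∪ {j})) :
    ex (bernoulliWeight p) (g * g) < ex (bernoulliWeight p) (f * f) := by
  rw [← sub_neg]
  unfold ex
  rw [← Finset.sum_sub_distrib]
  have h := sum_eq_sum_pairs i j hij (fun ω => bernoulliWeight p ω * (g * g) ω - bernoulliWeight p ω * (f * f) ω)
    (fun ω h1 h2 => by simp only [Pi.mul_apply, hg0 ω h1 h2, sub_self])
  rw [h]
  -- every pair term is `≤ 0`, the one at `ω₀` is `< 0`
  have hterm : ∀ ω : Set ι, i ∈ ω → j ∉ ω →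
      bernoulliWeight p ω * (g * g) ω - bernoulliWeight p ω * (f * f) ω +
        (bernoulliWeight p ((ω \ {i}) ∪ {j}) * (g * g) ((ω \ {i}) ∪ {j}) -
          bernoulliWeight p ((ω \ {i}) ∪ {j}) * (f * f) ((ω \ {i}) ∪ {j})) ≤ 0 ∧
      (f ω < f ((ω \ {i}) ∪ {j}) →
      bernoulliWeight p ω * (g * g) ω - bernoulliWeight p ω * (f * f) ω +
        (bernoulliWeight p ((ω \ {i}) ∪ {j}) * (g * g) ((ω \ {i}) ∪ {j}) -
          bernoulliWeight p ((ω \ {i}) ∪ {j}) * (f * f) ((ω \ {i}) ∪ {j})) < 0) := by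
    intro ω hiω hjω
    obtain ⟨h1, h2⟩ := hg ω hiω hjω
    simp only [Pi.mul_apply]
    rw [h1, h2]
    set u := f ω; set v := f ((ω \ {i}) ∪ {j})
    set wa := bernoulliWeight p ω; set wb := bernoulliWeight p ((ω \ {i}) ∪ {j})
    have hwa : 0 < wa := bernoulliWeight_pos p hp _
    have hwb : 0 < wb := bernoulliWeight_pos p hp _
    have hbal := pair_balance p hp i j m hm f g hg hij hiω hjω
    rw [h1, h2] at hbal
    by_cases huv : u < v
    · have hmv := wavg_mem' p hp i j m hm u v
      rw [min_eq_left huv.le, max_eq_right huv.le] at hmv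
      rw [max_eq_right hmv.1, min_eq_right hmv.2] at hbal ⊢
      set μ := m u v
      -- from the balance `wa (μ - u) + wb (μ - v) = 0` and `u < v`: `u < μ < v`… energy drop `= -(wa (μ-u)^2 + wb (v-μ)^2) < 0`
      have hid : wa * (μ * μ) - wa * (u * u) + (wb * (μ * μ) - wb * (v * v)) =
          -(wa * (μ - u) ^ 2 + wb * (μ - v) ^ 2) + 2 * μ * (wa * (μ - u) + wb * (μ - v)) := by ring
      rw [hid, hbal, mul_zero, add_zero]
      have hmu : u < μ := by
        -- if `μ = u` then the balance forces `wb (μ - v) = 0`, i.e. `μ = v`, contradicting `u < v`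
        rcases lt_or_eq_of_le hmv.1 with h | h
        · exact h
        · exfalso
          rw [← h, sub_self, mul_zero, zero_add] at hbal
          rcases mul_eq_zero.1 hbal with h' | h'
          · exact absurd h' (ne_of_gt hwb)
          · exact absurd (sub_eq_zero.1 h') (ne_of_lt (h ▸ huv))
      have hpos : 0 < wa * (μ - u) ^ 2 + wb * (μ - v) ^ 2 :=
        add_pos_of_pos_of_nonneg (mul_pos hwa (pow_pos (sub_pos.2 hmu) 2)) (mul_nonneg hwb.le (sq_nonneg _))
      exact ⟨by linarith, fun _ => by linarith⟩
    · have hvu : v ≤ u := not_lt.1 huv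
      have hmv := wavg_mem' p hp i j m hm u v
      rw [min_eq_right hvu, max_eq_left hvu] at hmv
      rw [max_eq_left hmv.2, min_eq_left hmv.1]
      exact ⟨le_of_eq (by ring), fun h => absurd h huv⟩
  have hω₀ : ω₀ ∈ Finset.univ.filter (fun ω : Set ι => i ∈ ω ∧ j ∉ ω) := Finset.mem_filter.2 ⟨Finset.mem_univ _, hi, hj⟩
  rw [← Finset.add_sum_erase _ _ hω₀]
  have hrest : ∑ ω ∈ (Finset.univ.filter (fun ω : Set ι => i ∈ ω ∧ j ∉ ω)).erase ω₀,
      (bernoulliWeight p ω * (g * g) ω - bernoulliWeight p ω * (f * f) ω +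
        (bernoulliWeight p ((ω \ {i}) ∪ {j}) * (g * g) ((ω \ {i}) ∪ {j}) -
          bernoulliWeight p ((ω \ {i}) ∪ {j}) * (f * f) ((ω \ {i}) ∪ {j}))) ≤ 0 :=
    Finset.sum_nonpos fun ω hω => by
      have hω' := (Finset.mem_filter.1 (Finset.mem_erase.1 hω).2).2
      exact (hterm ω hω'.1 hω'.2).1
  have h0 := (hterm ω₀ hi hj).2 hlt
  linarith

omit hm hg hg0 in
/-- **The averaging compression, definition-free package.**  For `p ∈ (0,1)^ι`, `i ≠ j` and any `f` there is `g` such that: `g` is increasing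
if `f` is; `[0,1]`-valued if `f` is; `F`-determined if `f` is (`i, j ∈ F`); `E[c g] = E[c f]` for every pair-symmetric `c`;
`E[c 1_B g] ≤ E[c 1_B f]` for `c ≥ 0` pair-symmetric and `B` closed under the trade `S+i ↦ S+j`; and `E[g²] < E[f²]` as soon as some pair is
unsorted (`f(S+i) < f(S+j)`). [this work] -/
theorem exists_avgCompression (hij : i ≠ j) : ∃ g : Set ι → ℝ,
    (Monotone f → Monotone g) ∧
    ((∀ ω, 0 ≤ f ω ∧ f ω ≤ 1) → ∀ ω, 0 ≤ g ω ∧ g ω ≤ 1) ∧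
    (∀ F : Finset ι, i ∈ F → j ∈ F → (∀ ω, f ω = f (ω ∩ (F : Set ι))) → ∀ ω, g ω = g (ω ∩ (F : Set ι))) ∧
    (∀ c : Set ι → ℝ, (∀ ω : Set ι, i ∈ ω → j ∉ ω → c ω = c ((ω \ {i}) ∪ {j})) →
      ex (bernoulliWeight p) (c * g) = ex (bernoulliWeight p) (c * f)) ∧
    (∀ c : Set ι → ℝ, (∀ ω : Set ι, i ∈ ω → j ∉ ω → c ω = c ((ω \ {i}) ∪ {j})) → (∀ ω, 0 ≤ c ω) →
      ∀ B : Set (Set ι), (∀ ω : Set ι, i ∈ ω → j ∉ ω → ω ∈ B → (ω \ {i}) ∪ {j} ∈ B) →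
      ex (bernoulliWeight p) (c * ind B * g) ≤ ex (bernoulliWeight p) (c * ind B * f)) ∧
    (∀ ω₀ : Set ι, i ∈ ω₀ → j ∉ ω₀ → f ω₀ < f ((ω₀ \ {i}) ∪ {j}) →
      ex (bernoulliWeight p) (g * g) < ex (bernoulliWeight p) (f * f)) := by
  obtain ⟨g, hg, hg0, hmono, hbox, hdet⟩ := exists_avgC_shape p hp i j hij f
  have hm : ∀ u v : ℝ, (fun u v : ℝ => ((p i : ℝ) * (1 - (p j : ℝ)) * u + (1 - (p i : ℝ)) * (p j : ℝ) * v) / ((p i : ℝ) * (1 - (p j : ℝ)) + (1 - (p i : ℝ)) * (p j : ℝ))) u v = ((p i : ℝ) * (1 - (p j : ℝ)) * u + (1 - (p i : ℝ)) * (p j : ℝ) * v) / ((p i : ℝ) * (1 - (p j : ℝ)) + (1 - (p i : ℝ)) * (p j : ℝ)) := fun _ _ => rfl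
  exact ⟨g, hmono, hbox, hdet, fun c hc => ex_pairConst_avgCompress p hp i j _ hm f g hg hg0 hij c hc,
    fun c hc hc0 B hB => ex_rightClosed_avgCompress_le p hp i j _ hm f g hg hg0 hij c hc hc0 hB,
    fun ω₀ hi hj hlt => energy_avgCompress_lt p hp i j _ hm f g hg hg0 hij hi hj hlt⟩

end avg
/-! ## §4 Existence: the fuzzy compression lemma -/

section existence
variable (p : ι → unitInterval) (hp : ∀ e, 0 < (p e : ℝ) ∧ (p e : ℝ) < 1)
include hp

omit hp in
/-- `φ ↦ E[c φ d]` is continuous (a finite sum). [folklore] -/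
private theorem continuous_ex_mul_mul (c d : Set ι → ℝ) : Continuous (fun φ : Set ι → ℝ => ex (bernoulliWeight p) (c * φ * d)) := by
  unfold ex; simp only [Pi.mul_apply]
  exact continuous_finsetSum _ fun ω _ => continuous_const.mul ((continuous_const.mul (continuous_apply ω)).mul continuous_const)

omit hp in
/-- `φ ↦ E[φ²]` is continuous. [folklore] -/
private theorem continuous_energy : Continuous (fun φ : Set ι → ℝ => ex (bernoulliWeight p) (φ * φ)) := by
  unfold ex; simp only [Pi.mul_apply]
  exact continuous_finsetSum _ fun ω _ => continuous_const.mul ((continuous_apply ω).mul (continuous_apply ω))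

/-- **THE FUZZY COMPRESSION LEMMA.**  `p ∈ (0,1)^ι`, `F` ranked by `σ`, `H` invariant under trades inside `F`, `B` closed under upward trades
(`σ x < σ y`, `x ∈ ω ∌ y`, `ω ∈ B` ⟹ `ω − x + y ∈ B`), `f₀` increasing `F`-determined `[0,1]`-valued ⟹ there is `φ` increasing, `F`-determined,
`[0,1]`-valued, LEFT-SHIFTED (`φ ω ≤ φ(ω − x + y)`, `σ y < σ x`, `x ∈ ω ∌ y`), `E[1_H φ] = E[1_H f₀]`, `E φ = E f₀`, `E[1_H φ 1_B] ≤ E[1_H f₀ 1_B]`. [this work] -/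
theorem exists_leftShifted_surrogate (F : Finset ι) (σ : ι → ℕ) {H B : Set (Set ι)}
    (hH : ∀ ω : Set ι, ∀ x ∈ F, ∀ y ∈ F, x ∈ ω → y ∉ ω → (ω ∈ H ↔ (ω \ {x}) ∪ {y} ∈ H))
    (hB : ∀ ω : Set ι, ∀ x ∈ F, ∀ y ∈ F, σ x < σ y → x ∈ ω → y ∉ ω → ω ∈ B → (ω \ {x}) ∪ {y} ∈ B)
    (f₀ : Set ι → ℝ) (hf₀m : Monotone f₀) (hf₀b : ∀ ω, 0 ≤ f₀ ω ∧ f₀ ω ≤ 1) (hf₀F : ∀ ω, f₀ ω = f₀ (ω ∩ (F : Set ι))) :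
    ∃ φ : Set ι → ℝ, Monotone φ ∧ (∀ ω, 0 ≤ φ ω ∧ φ ω ≤ 1) ∧ (∀ ω, φ ω = φ (ω ∩ (F : Set ι))) ∧
      (∀ ω : Set ι, ∀ x ∈ F, ∀ y ∈ F, σ y < σ x → x ∈ ω → y ∉ ω → φ ω ≤ φ ((ω \ {x}) ∪ {y})) ∧
      ex (bernoulliWeight p) (ind H * φ) = ex (bernoulliWeight p) (ind H * f₀) ∧
      ex (bernoulliWeight p) φ = ex (bernoulliWeight p) f₀ ∧
      ex (bernoulliWeight p) (ind H * φ * ind B) ≤ ex (bernoulliWeight p) (ind H * f₀ * ind B) := by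
  -- the admissible set: a closed subset of the compact box `[0,1]^(Set ι)`
  set C : Set (Set ι → ℝ) := {φ | Monotone φ ∧ (∀ ω, φ ω = φ (ω ∩ (F : Set ι))) ∧
      ex (bernoulliWeight p) (ind H * φ) = ex (bernoulliWeight p) (ind H * f₀) ∧
      ex (bernoulliWeight p) φ = ex (bernoulliWeight p) f₀ ∧
      ex (bernoulliWeight p) (ind H * φ * ind B) ≤ ex (bernoulliWeight p) (ind H * f₀ * ind B)} with hC
  set K : Set (Set ι → ℝ) := Set.pi Set.univ (fun _ => Set.Icc (0 : ℝ) 1) ∩ C with hK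
  have hCclosed : IsClosed C := by
    have e1 : C = {φ : Set ι → ℝ | Monotone φ} ∩ ({φ | ∀ ω, φ ω = φ (ω ∩ (F : Set ι))} ∩
        ({φ | ex (bernoulliWeight p) (ind H * φ) = ex (bernoulliWeight p) (ind H * f₀)} ∩
        ({φ | ex (bernoulliWeight p) φ = ex (bernoulliWeight p) f₀} ∩
        {φ | ex (bernoulliWeight p) (ind H * φ * ind B) ≤ ex (bernoulliWeight p) (ind H * f₀ * ind B)}))) := by
      ext φ; simp only [hC, Set.mem_setOf_eq, Set.mem_inter_iff]
    rw [e1]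
    refine IsClosed.inter ?_ (IsClosed.inter ?_ (IsClosed.inter ?_ (IsClosed.inter ?_ ?_)))
    · have : {φ : Set ι → ℝ | Monotone φ} = ⋂ ω : Set ι, ⋂ η : Set ι, {φ | ω ⊆ η → φ ω ≤ φ η} := by
        ext φ; simp only [Set.mem_setOf_eq, Set.mem_iInter]; exact ⟨fun h ω η hle => h hle, fun h ω η hle => h ω η hle⟩
      rw [this]
      refine isClosed_iInter fun ω => isClosed_iInter fun η => ?_
      by_cases hle : ω ⊆ η
      · have : {φ : Set ι → ℝ | ω ⊆ η → φ ω ≤ φ η} = {φ | φ ω ≤ φ η} := by ext φ; simp [hle]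
        rw [this]; exact isClosed_le (continuous_apply ω) (continuous_apply η)
      · have : {φ : Set ι → ℝ | ω ⊆ η → φ ω ≤ φ η} = Set.univ := by ext φ; simp [hle]
        rw [this]; exact isClosed_univ
    · have : {φ : Set ι → ℝ | ∀ ω, φ ω = φ (ω ∩ (F : Set ι))} = ⋂ ω : Set ι, {φ | φ ω = φ (ω ∩ (F : Set ι))} := by
        ext φ; simp only [Set.mem_setOf_eq, Set.mem_iInter]
      rw [this]
      exact isClosed_iInter fun ω => isClosed_eq (continuous_apply ω) (continuous_apply _)
    · exact isClosed_eq (by simpa using continuous_ex_mul_mul p (ind H) 1) continuous_const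
    · exact isClosed_eq (by simpa using continuous_ex_mul_mul p 1 1) continuous_const
    · exact isClosed_le (continuous_ex_mul_mul p (ind H) (ind B)) continuous_const
  have hKc : IsCompact K := (isCompact_univ_pi fun _ => isCompact_Icc).inter_right hCclosed
  have hf₀K : f₀ ∈ K := by
    refine ⟨Set.mem_univ_pi.2 fun ω => ⟨(hf₀b ω).1, (hf₀b ω).2⟩, hf₀m, hf₀F, rfl, rfl, le_rfl⟩
  obtain ⟨φ, hφK, hmin⟩ := hKc.exists_isMinOn ⟨f₀, hf₀K⟩ (continuous_energy p).continuousOn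
  obtain ⟨hφbox, hφm, hφF, hφH, hφ1, hφB⟩ := hφK
  have hφb : ∀ ω, 0 ≤ φ ω ∧ φ ω ≤ 1 := fun ω => by
    have := Set.mem_univ_pi.1 hφbox ω; exact ⟨this.1, this.2⟩
  refine ⟨φ, hφm, hφb, hφF, ?_, hφH, hφ1, hφB⟩
  -- sortedness: otherwise an averaging compression improves the energy inside `K`
  intro ω x hx y hy hyx hxω hyω
  by_contra hlt
  rw [not_le] at hlt
  have hne : y ≠ x := fun h => by rw [h] at hyx; exact lt_irrefl _ hyx
  -- the pair seen from `ω₀ = ω − x + y` (which contains `y` and not `x`)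
  set ω₀ : Set ι := (ω \ {x}) ∪ {y} with hω₀
  have hyω₀ : y ∈ ω₀ := Or.inr rfl
  have hxω₀ : x ∉ ω₀ := by
    intro h
    rcases h with ⟨_, hxx⟩ | h'
    · exact hxx rfl
    · exact hne.symm h'
  have hback : (ω₀ \ {y}) ∪ {x} = ω := trade_trade hne.symm hxω hyω
  have hlt' : φ ω₀ < φ ((ω₀ \ {y}) ∪ {x}) := by rw [hback]; exact hlt
  obtain ⟨g, hgm, hgb, hgF, hgc, hgB, hgE⟩ := exists_avgCompression p hp y x φ hne
  have hcH : ∀ η : Set ι, y ∈ η → x ∉ η → ind H η = ind H ((η \ {y}) ∪ {x}) := fun η hyη hxη => by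
    by_cases h : η ∈ H
    · rw [ind_of_mem h, ind_of_mem ((hH η y hy x hx hyη hxη).1 h)]
    · rw [ind_of_not_mem h, ind_of_not_mem (fun h' => h ((hH η y hy x hx hyη hxη).2 h'))]
  have hgK : g ∈ K := by
    refine ⟨Set.mem_univ_pi.2 fun η => ?_, hgm hφm, hgF F hy hx hφF, ?_, ?_, ?_⟩
    · have := hgb hφb η; exact ⟨this.1, this.2⟩
    · rw [hφH.symm]
      exact hgc (ind H) hcH
    · have hone : ∀ ψ : Set ι → ℝ, ex (bernoulliWeight p) ((fun _ => (1 : ℝ)) * ψ) = ex (bernoulliWeight p) ψ :=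
        fun ψ => ex_congr' fun η => by simp only [Pi.mul_apply, one_mul]
      have h := hgc (fun _ => (1 : ℝ)) (fun _ _ _ => rfl)
      rw [hone, hone] at h
      rw [hφ1.symm]
      exact h
    · refine le_trans ?_ hφB
      have h := hgB (ind H) hcH (fun η => ind_nonneg _ _) B (fun η hyη hxη hηB => hB η y hy x hx hyx hyη hxη hηB)
      rw [mul_right_comm (ind H) (ind B) g, mul_right_comm (ind H) (ind B) φ] at h
      exact h
  have hlt_energy := hgE ω₀ hyω₀ hxω₀ hlt'
  exact absurd (hmin hgK) (not_le.2 hlt_energy)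

end existence

end SahiOneStep

end Summit.CriticalPhenomena.PercolationContinuityZ3.Theorems
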